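import Summits.ValiantsHypothesis.ValiantsHypothesis.Theses.SummationBits
import Literature.Computability.AlgebraicComplexity.CircuitGateSemantics
import Literature.Computability.AlgebraicComplexity.DepthThreeChasmCircuits

/-!
# ValiantsHypothesis / SummationBits — `GateCountSuffices` (gates versus wires at depth three)

Route `ValiantsHypothesis/SummationBits`, item `stmt-ValiantsHypothesis-7568` (support, glue to the
tree's measure `Literature.Computability.AlgebraicComplexity.productDepthCircuitSize`): if for
every `c` some `n` has `productDepthCircuitSize 1 (per_n) > (n+2)^(c⌊√n⌋+c)` (GATES counted), then
the route thesis `Depth3Thesis` (WIRES counted: `edgeSize`) holds.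

The only point is that the tree's circuits may contain arbitrarily many wire-free gates (`∑ ∅ = 0`,
`∏ ∅ = 1`) and arbitrarily many unused gates, so `size ≤ edgeSize + 1` fails in general. We prove
the normal form behind the informal statement: a circuit `P` of product-depth `≤ 1` with `E` wires
computes `∑_{τ} c_τ ∏_{π} ℓ_{τπ}` with at most `E + 1` summands of at most `E + 1` affine factors
each, namely one summand per product gate of product-depth `≤ 1` having at least one operand (their
number is at most the number of wires), plus one affine summand; rebuilt as the `ΣΠΣ` circuit
`DepthThreeChasm.spsCircuit` this has `≤ (E + 2)²` gates (`exists_small_circuit`). The structural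
input is the tree's per-gate semantics (`CircuitGateSemantics.lean`: sum closure
`gateVal_mem_span_spanFamily`, `gateVal_of_prod`, `opPD_succ_le_gatePD_of_prod`) and the `ΣΠΣ`
builder of `DepthThreeChasmCircuits.lean` (`spsCircuit`, `eval_spsCircuit`,
`productDepth_spsCircuit_le`). The item then follows by the growth comparison
`(E + 2)² ≤ (n+2)^(2(c⌊√n⌋+c)+4) ≤ (n+2)^(c'⌊√n⌋+c')` with `c' = 2c + 4`.

## References

* N. Limaye, S. Srinivasan, S. Tavenas, *Superpolynomial lower bounds against low-depth algebraic
  circuits*, FOCS 2021 / J. ACM 72 (2025), §1–§2 (product-depth, size as gates or wires).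
* A. Gupta, P. Kamath, N. Kayal, R. Saptharishi, *Arithmetic circuits: a chasm at depth three*,
  SIAM J. Comput. 45 (2016), §1 eq. (1) (`ΣΠΣ` circuits `∑ ∏ ℓ_{ij}`).
-/

noncomputable section

open MvPolynomial

-- `Summit.ValiantsHypothesis.ValiantsHypothesis.…` is the tree's mandated single-conjunct layout
-- (Sub = Summit), so the duplicated namespace component is intended.
set_option linter.dupNamespace false

namespace Summit.ValiantsHypothesis.ValiantsHypothesis.Theorems.SummationBitsGateCountSuffices

open Literature.Computability.AlgebraicComplexity
open Literature.Computability.AlgebraicComplexity.ArithCircuit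
open Literature.Computability.AlgebraicComplexity.DepthThreeChasm

universe u v

variable {k : Type u} {σ : Type v}

/-! ## Product gates and wires -/

section Structural

/-- A product gate has product-depth at least `1` (it weighs `1` in the product-depth fold;
LST 2021 §1). [cite: LimayeSrinivasanTavenas2021, §1] -/
theorem one_le_gatePD_of_prod (P : ArithCircuit k σ) {i : ℕ} {args : List (Operand k σ)}
    (hg : P.gates[i]? = some (.prod args)) : 1 ≤ P.gatePD i := by
  unfold ArithCircuit.gatePD
  rw [List.getD_eq_getElem?_getD, gateWDepths_getElem? prodWeight P.gates i _ hg, Option.getD_some]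
  simp [prodWeight, Gate.isProd]

/-- The fan-in of any gate is at most the number of wires of the circuit. [cite:
LimayeSrinivasanTavenas2021, §2] -/
theorem fanIn_le_edgeSize (P : ArithCircuit k σ) {i : ℕ} {g : Gate k σ} (hg : P.gates[i]? = some g) :
    g.fanIn ≤ P.edgeSize := by
  unfold ArithCircuit.edgeSize
  have hmem : g ∈ P.gates := List.mem_of_getElem? hg
  exact List.le_sum_of_mem (List.mem_map.2 ⟨g, hmem, rfl⟩)

open scoped Classical in
/-- The number of gates with at least one operand is at most the number of wires: counting the
product gates of product-depth `≤ 1` with a nonempty operand list. [cite: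
LimayeSrinivasanTavenas2021, §2] -/
theorem card_heavy_le_edgeSize (P : ArithCircuit k σ) :
    Fintype.card {j : Fin P.size // ∃ args, P.gates[(j : ℕ)]? = some (.prod args) ∧ args ≠ [] ∧
      P.gatePD j ≤ 1} ≤ P.edgeSize := by
  classical
  set F : Fin P.size → ℕ := fun j => (P.gates[(j : ℕ)]'j.2).fanIn with hF
  have hsum : ∑ j : Fin P.size, F j = P.edgeSize := by
    unfold ArithCircuit.edgeSize
    rw [← Fin.sum_univ_fun_getElem]
    rfl
  rw [Fintype.card_subtype, Finset.card_eq_sum_ones, ← hsum]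
  refine (Finset.sum_le_sum (f := fun _ => 1) (g := F) ?_).trans
    (Finset.sum_le_sum_of_subset_of_nonneg (Finset.filter_subset _ _) fun _ _ _ => Nat.zero_le _)
  intro j hj
  simp only [Finset.mem_filter, Finset.mem_univ, true_and] at hj
  obtain ⟨args, hargs, hne, -⟩ := hj
  have hget : P.gates[(j : ℕ)]'j.2 = .prod args := by
    have := (List.getElem?_eq_some_iff.1 hargs)
    obtain ⟨h, h'⟩ := this
    exact h'
  simp only [hF, hget, Gate.fanIn, Gate.args]
  exact Nat.pos_of_ne_zero fun h => hne (List.length_eq_zero_iff.1 h)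

variable [CommSemiring k]

/-- At product-depth `0` the spanning family has no product-gate entries (product gates have
product-depth `≥ 1`). [cite: LimayeSrinivasanTavenas2021, §1] -/
theorem spanFamily_zero_inl (P : ArithCircuit k σ) (j : Fin P.size) : P.spanFamily 0 (.inl j) = 0 := by
  rcases P.spanFamily_inl_eq 0 j with h | ⟨⟨args, hargs⟩, hpd, -⟩
  · exact h
  · exact absurd (one_le_gatePD_of_prod P hargs) (by omega)

/-- The polynomial computed by a circuit of product-depth `≤ 1` is a linear combination of the
values of its product gates of product-depth `≤ 1`, the variables and `1` (sum closure,
LST 2025 Lemma 19 eq. (1), at the output). [cite: LimayeSrinivasanTavenas2021, §1] -/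
theorem eval_mem_span_one (P : ArithCircuit k σ) (hP : P.productDepth ≤ 1) :
    P.eval ∈ Submodule.span k (Set.range (P.spanFamily 1)) := by
  rw [P.eval_eq_opVal_output]
  have hpd := P.productDepth_eq_opPD_output
  cases hout : P.output with
  | var v =>
    rw [opVal_var]
    exact Submodule.subset_span ⟨.inr (.inl v), rfl⟩
  | const c =>
    rw [opVal_const, ← mul_one (MvPolynomial.C c), MvPolynomial.C_mul']
    exact Submodule.smul_mem _ _ (Submodule.subset_span ⟨.inr (.inr ()), rfl⟩)
  | gate j =>
    rw [opVal_gate]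
    split_ifs with hj
    · have h1 : P.gatePD j ≤ 1 := by
        rw [hout, opPD_gate, if_pos hj] at hpd
        omega
      exact P.span_spanFamily_mono h1 (P.gateVal_mem_span_spanFamily j)
    · exact Submodule.zero_mem _

/-- Reduction of the spanning family to the *heavy* product gates (product-depth `≤ 1`, at least
one operand): a product gate with no operand computes `1`. [cite: LimayeSrinivasanTavenas2021, §1] -/
theorem eval_mem_span_heavy (P : ArithCircuit k σ) (hP : P.productDepth ≤ 1) :
    P.eval ∈ Submodule.span k (Set.range (Sum.elim
      (fun s : {j : Fin P.size // ∃ args, P.gates[(j : ℕ)]? = some (.prod args) ∧ args ≠ [] ∧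
        P.gatePD j ≤ 1} => P.gateVal s.1)
      (Sum.elim (fun v : σ => (X v : MvPolynomial σ k)) (fun _ : Unit => (1 : MvPolynomial σ k))))) := by
  refine Submodule.span_le.2 ?_ (eval_mem_span_one P hP)
  rintro _ ⟨i, rfl⟩
  rcases i with j | v | u
  · rcases P.spanFamily_inl_eq 1 j with h | ⟨⟨args, hargs⟩, hpd, h⟩
    · rw [h]; exact Submodule.zero_mem _
    · rw [h]
      by_cases hne : args = []
      · subst hne
        rw [P.gateVal_of_prod hargs, List.map_nil, List.prod_nil]
        exact Submodule.subset_span ⟨.inr (.inr ()), rfl⟩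
      · exact Submodule.subset_span ⟨.inl ⟨j, args, hargs, hne, hpd⟩, rfl⟩
  · exact Submodule.subset_span ⟨.inr (.inl v), rfl⟩
  · exact Submodule.subset_span ⟨.inr (.inr u), rfl⟩

end Structural

/-! ## Affine forms -/

section Affine

variable [CommSemiring k] [Fintype σ]

/-- A variable is an affine form: `X v = affVal (e_v, 0)`. [folklore] -/
theorem affVal_single [DecidableEq σ] (v : σ) :
    affVal ((fun j => if j = v then (1 : k) else 0), (0 : k)) = (X v : MvPolynomial σ k) := by
  rw [affVal_apply, C_0, add_zero]
  simp [ite_smul]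

/-- A constant is an affine form: `C c = affVal (0, c)`. [folklore] -/
theorem affVal_zero_const (c : k) : affVal ((0 : σ → k), c) = (C c : MvPolynomial σ k) := by
  simp [affVal_apply]

/-- Zero is an affine form. [folklore] -/
theorem affVal_zero_zero : affVal ((0 : σ → k), (0 : k)) = (0 : MvPolynomial σ k) := by
  simp [affVal_apply]

/-- Elements of the product-depth-`0` span (variables and `1` only) are affine forms. [cite:
LimayeSrinivasanTavenas2021, §1] -/
theorem exists_affVal_of_mem_span_zero (P : ArithCircuit k σ) {f : MvPolynomial σ k}
    (hf : f ∈ Submodule.span k (Set.range (P.spanFamily 0))) :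
    ∃ φ : (σ → k) × k, f = affVal φ := by
  classical
  obtain ⟨c, rfl⟩ := (Submodule.mem_span_range_iff_exists_fun k).1 hf
  refine ⟨(fun v => c (.inr (.inl v)), c (.inr (.inr ()))), ?_⟩
  rw [Fintype.sum_sum_type, Fintype.sum_sum_type, affVal_apply]
  simp only [spanFamily_zero_inl, smul_zero, Finset.sum_const_zero, zero_add, Finset.univ_unique,
    Finset.sum_singleton]
  simp [ArithCircuit.spanFamily, MvPolynomial.smul_eq_C_mul]

/-- A gate of product-depth `0` computes an affine form. [cite: LimayeSrinivasanTavenas2021, §1] -/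
theorem exists_affVal_gateVal (P : ArithCircuit k σ) {j : ℕ} (hj : P.gatePD j = 0) :
    ∃ φ : (σ → k) × k, P.gateVal j = affVal φ := by
  have h := P.gateVal_mem_span_spanFamily j
  rw [hj] at h
  exact exists_affVal_of_mem_span_zero P h

/-- The operands of a product gate of product-depth `≤ 1` denote affine forms (they have
product-depth `0`). [cite: LimayeSrinivasanTavenas2021, §1] -/
theorem exists_affVal_opVal (P : ArithCircuit k σ) {i : ℕ} {args : List (Operand k σ)}
    (hg : P.gates[i]? = some (.prod args)) (hpd : P.gatePD i ≤ 1) {u : Operand k σ}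
    (hu : u ∈ args) : ∃ φ : (σ → k) × k, P.opVal i u = affVal φ := by
  classical
  have h0 : P.opPD i u = 0 := by
    have := P.opPD_succ_le_gatePD_of_prod hg hu
    omega
  cases u with
  | var v => exact ⟨_, (affVal_single v).symm⟩
  | const c => exact ⟨_, (affVal_zero_const c).symm⟩
  | gate j =>
    rw [opVal_gate]
    split_ifs with hji
    · apply exists_affVal_gateVal P
      simpa [ArithCircuit.opPD, hji] using h0
    · exact ⟨_, affVal_zero_zero.symm⟩

/-- A list of affine values is the value list of a list of affine forms. [folklore] -/
theorem exists_list_affVal {ι : Type*} (g : ι → MvPolynomial σ k) :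
    ∀ l : List ι, (∀ u ∈ l, ∃ φ : (σ → k) × k, g u = affVal φ) →
      ∃ A : List ((σ → k) × k), A.length = l.length ∧ (l.map g).prod = (A.map affVal).prod
  | [], _ => ⟨[], rfl, rfl⟩
  | u :: l, h => by
    obtain ⟨φ, hφ⟩ := h u List.mem_cons_self
    obtain ⟨A, hA, hprod⟩ := exists_list_affVal g l fun w hw => h w (List.mem_cons_of_mem _ hw)
    exact ⟨φ :: A, by simp [hA], by simp [hφ, hprod]⟩

/-- **A product gate of product-depth `≤ 1` computes a product of `fanIn` affine forms.** [cite: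
LimayeSrinivasanTavenas2021, §1] -/
theorem exists_list_affVal_gateVal (P : ArithCircuit k σ) {i : ℕ} {args : List (Operand k σ)}
    (hg : P.gates[i]? = some (.prod args)) (hpd : P.gatePD i ≤ 1) :
    ∃ A : List ((σ → k) × k), A.length = args.length ∧ P.gateVal i = (A.map affVal).prod := by
  obtain ⟨A, hA, hprod⟩ :=
    exists_list_affVal (P.opVal i) args fun u hu => exists_affVal_opVal P hg hpd hu
  exact ⟨A, hA, by rw [P.gateVal_of_prod hg, hprod]⟩

/-! ## The `ΣΠΣ` rebuild, counted in gates -/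

/-- The `ΣΠΣ` circuit `spsCircuit T D c ℓ` has `T · D + T + 1` gates. [cite:
GuptaKamathKayalSaptharishi2016, §1 eq. (1)] -/
theorem size_spsCircuit (T D : ℕ) (c : Fin T → k) (ℓ : Fin T → Fin D → (σ → k) × k) :
    (spsCircuit T D c ℓ).size = T * D + T + 1 := by
  simp [spsCircuit, ArithCircuit.size, length_layerA, length_layerB, Nat.add_assoc]

/-- The `ΣΠΣ` builder, list-fed form, counted in gates: `#𝒯` terms `c_τ · ∏ (A τ)` with at most
`D` affine factors each are computed with product-depth `≤ 1` by `#𝒯 · D + #𝒯 + 1` gates. [cite: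
GuptaKamathKayalSaptharishi2016, §1 eq. (1)] -/
theorem exists_sps_circuit_size {𝒯 : Type*} [Fintype 𝒯] (D : ℕ) (c : 𝒯 → k)
    (A : 𝒯 → List ((σ → k) × k)) (hA : ∀ τ, (A τ).length ≤ D) :
    ∃ C : ArithCircuit k σ, C.eval = ∑ τ, c τ • ((A τ).map affVal).prod ∧
      C.productDepth ≤ 1 ∧ C.size = Fintype.card 𝒯 * D + Fintype.card 𝒯 + 1 := by
  set T := Fintype.card 𝒯 with hT
  set e := Fintype.equivFin 𝒯 with he
  set c' : Fin T → k := fun τ => c (e.symm τ) with hc'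
  set ℓ' : Fin T → Fin D → (σ → k) × k := fun τ π => (A (e.symm τ)).getD π.val (0, 1) with hℓ'
  refine ⟨spsCircuit T D c' ℓ', ?_, productDepth_spsCircuit_le T D c' ℓ', size_spsCircuit T D c' ℓ'⟩
  rw [eval_spsCircuit, ← e.symm.sum_comp]
  refine Fintype.sum_congr _ _ fun τ => ?_
  simp only [hc', hℓ']
  rw [prod_affVal_getD _ _ (hA _)]

/-- **Gates versus wires at product-depth one.** A circuit of product-depth `≤ 1` with `E` wires
computes the same polynomial as a `ΣΠΣ` circuit with at most `(E + 2)²` gates: one summand per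
product gate with at least one operand (at most `E` of them, each a product of at most `E` affine
forms) plus one affine summand. [cite: LimayeSrinivasanTavenas2021, §1–§2] -/
theorem exists_small_circuit (P : ArithCircuit k σ) (hP : P.productDepth ≤ 1) :
    ∃ Q : ArithCircuit k σ, Q.eval = P.eval ∧ Q.productDepth ≤ 1 ∧ Q.size ≤ (P.edgeSize + 2) ^ 2 := by
  classical
  obtain ⟨d, hd⟩ := (Submodule.mem_span_range_iff_exists_fun k).1 (eval_mem_span_heavy P hP)
  -- factor lists of the heavy product gates
  have hA : ∀ s : {j : Fin P.size // ∃ args, P.gates[(j : ℕ)]? = some (.prod args) ∧ args ≠ [] ∧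
      P.gatePD j ≤ 1}, ∃ A : List ((σ → k) × k), A.length ≤ P.edgeSize + 1 ∧
        P.gateVal s.1 = (A.map affVal).prod := by
    intro s
    obtain ⟨args, hargs, -, hpd⟩ := s.2
    obtain ⟨A, hA, hval⟩ := exists_list_affVal_gateVal P hargs hpd
    refine ⟨A, ?_, hval⟩
    have := fanIn_le_edgeSize P hargs
    simp only [Gate.fanIn, Gate.args] at this
    omega
  choose A hAlen hAval using hA
  set φ₀ : (σ → k) × k := (fun v => d (.inr (.inl v)), d (.inr (.inr ())))
  obtain ⟨Q, hQe, hQpd, hQs⟩ := exists_sps_circuit_size (P.edgeSize + 1)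
    (Sum.elim (fun s => d (.inl s)) (fun _ : Unit => (1 : k)))
    (Sum.elim A (fun _ : Unit => [φ₀]))
    (by rintro (s | u) <;> simp [hAlen])
  refine ⟨Q, ?_, hQpd, ?_⟩
  · rw [hQe, ← hd, Fintype.sum_sum_type, Fintype.sum_sum_type, Fintype.sum_sum_type]
    simp only [Sum.elim_inl, Sum.elim_inr, Finset.univ_unique, Finset.sum_singleton, List.map_cons,
      List.map_nil, List.prod_cons, List.prod_nil, mul_one, one_smul, ← hAval]
    congr 1
    rw [affVal_apply, MvPolynomial.smul_eq_C_mul, mul_one]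
  · rw [hQs, Fintype.card_sum, Fintype.card_unit]
    have hc := card_heavy_le_edgeSize P
    set T := Fintype.card {j : Fin P.size // ∃ args, P.gates[(j : ℕ)]? = some (.prod args) ∧
      args ≠ [] ∧ P.gatePD j ≤ 1}
    nlinarith

end Affine

/-! ## The item -/

/-- Settles stmt-ValiantsHypothesis-7568 (`GateCountSuffices`, route SummationBits): a
super-`(n+2)^(c⌊√n⌋+c)` lower bound for every `c` on the product-depth-`1` GATE count of `per_n`
implies the same for the WIRE count (`Depth3Thesis`): a circuit with `E ≤ (n+2)^(c⌊√n⌋+c)` wires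
is rebuilt with `≤ (E+2)² ≤ (n+2)^((2c+4)⌊√n⌋+2c+4)` gates (`exists_small_circuit`), so the
hypothesis at `c' = 2c + 4` is contradicted. [folklore] -/
theorem gateCountSuffices_proof :
    Summit.ValiantsHypothesis.ValiantsHypothesis.Theses.SummationBits.GateCountSuffices := by
  unfold Summit.ValiantsHypothesis.ValiantsHypothesis.Theses.SummationBits.GateCountSuffices
    Summit.ValiantsHypothesis.ValiantsHypothesis.Theses.SummationBits.Depth3Thesis
  intro h c
  obtain ⟨n, hn⟩ := h (2 * c + 4)
  refine ⟨n, fun P hP hd => ?_⟩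
  by_contra hlt
  push Not at hlt
  obtain ⟨Q, hQe, hQd, hQs⟩ := exists_small_circuit P hd
  have hQc : Q.Computes (perPoly (Fin n) ℂ) := by
    unfold ArithCircuit.Computes at hP ⊢
    rw [hQe, hP]
  have h1 := productDepthCircuitSize_le hQc hQd
  have h2 := lt_of_lt_of_le hn h1
  have h3 : (n + 2) ^ ((2 * c + 4) * Nat.sqrt n + (2 * c + 4)) < Q.size := by
    have hcast : ((n + 2 : ℕ∞) ^ ((2 * c + 4) * Nat.sqrt n + (2 * c + 4))) =
        (((n + 2) ^ ((2 * c + 4) * Nat.sqrt n + (2 * c + 4)) : ℕ) : ℕ∞) := by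
      push_cast
      rfl
    rw [hcast] at h2
    exact_mod_cast h2
  set m := n + 2 with hm_def
  set e := c * Nat.sqrt n + c with he_def
  have hm : 2 ≤ m := by omega
  have hm2 : 4 ≤ m ^ 2 := by nlinarith
  have hE : P.edgeSize + 2 ≤ m ^ 2 * m ^ e := by
    have hB : 1 ≤ m ^ e := Nat.one_le_pow _ _ (by omega)
    calc P.edgeSize + 2 ≤ 4 * m ^ e := by omega
      _ ≤ m ^ 2 * m ^ e := Nat.mul_le_mul_right _ hm2
  have h4 : Q.size ≤ m ^ (2 * e + 4) := by
    calc Q.size ≤ (P.edgeSize + 2) ^ 2 := hQs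
      _ ≤ (m ^ 2 * m ^ e) ^ 2 := Nat.pow_le_pow_left hE 2
      _ = m ^ (2 * e + 4) := by ring
  have h5 : m ^ (2 * e + 4) ≤ m ^ ((2 * c + 4) * Nat.sqrt n + (2 * c + 4)) :=
    Nat.pow_le_pow_right (by omega) (by rw [he_def]; nlinarith [Nat.zero_le (Nat.sqrt n)])
  omega

end Summit.ValiantsHypothesis.ValiantsHypothesis.Theorems.SummationBitsGateCountSuffices
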